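import Mathlib
import HarnessLib
import Summits.CriticalPhenomena.PercolationContinuityZ3.Theses.PercLowPointHalfSpace
import Summits.CriticalPhenomena.PercolationContinuityZ3.Theorems.PercLowPointHalfSpaceLowPointBookkeepingStemTransport
import Summits.CriticalPhenomena.PercolationContinuityZ3.Theorems.PercLowPointHalfSpaceBoundaryTwoArmDecayStubCensusDefs

/-!
# Crux `LowPointBookkeeping` (stmt-CriticalPhenomena-14713), line `SketchIdeator4`: the two floor mass
# transports of the stem inequality (helper 2/3 of the registered stub `stub_stemLevel`)

For an apex `x = u + r e₀` above a floor point `u` of `ℤ³` (bond percolation at any `p`, `ℍ = {0 ≤ x₀}`):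

* TRANSPORT 1 (`lintegral_W_eq`): sending mass `w_r(x) = 1/|F_r(x)|` from `x`, on the localised point-to-wall
  event `W_r(x)`, to each of its feet `F_r(x) = {f ∈ ∂ℍ | x ↔ f in Q_{2r}(x) ∩ ℍ}` and applying the floor
  mass-transport principle (`BoundaryTwoArmDecay.stub_census_floorMTP`, landed) gives
  `P_p(W_r(r e₀)) = ∫ Σ_u 𝚽(u) dP_p`, `𝚽(u) = 𝟙{u ∈ ∂ℍ} 𝟙_{W_r(x_u)} 𝟙{0 ∈ F_r(x_u)} w_r(x_u)`;
* TRANSPORT 2 (`lintegral_thin_le`): the thin transport `Σ_u Σ_a 𝚿(u, a, 0)` (mass `w_r(x_u)` routed through a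
  thin foot `a`, `|G_r(a)| < t`, to the receiver `0`) is re-rooted at the thin foot by a second floor MTP; the
  receiver sum `Σ_b 𝟙{b ∈ F_r(x)} w_r(x)` is EXACTLY `1`, whence
  `∫ Σ_u Σ_a 𝚿(u, a, 0) ≤ Σ_{x ∈ B_r, x₀ = r} P_p(locFoot_r < t, 0 ↔_ℍ x)`.

Lands `--supports stmt-CriticalPhenomena-14713` with the registered def-free sub-goal `stub_stemApexSum` (the
support/reindexing lemma used by both transports).  Objects and covariance: `…StemTransport.lean`; the split and
the assembly: `…StemLevel.lean`.

References: R. Lyons – Y. Peres, *Probability on Trees and Networks* (2016), §8.2; G. Grimmett, *Percolation*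
(1999), §1.6.
-/

noncomputable section

open MeasureTheory Filter Topology
open Literature.Probability.Percolation Literature.Probability.LatticeModels
open scoped ENNReal Classical

namespace Summit.CriticalPhenomena.PercolationContinuityZ3.Theorems.StemCriterion

open Summit.CriticalPhenomena.PercolationContinuityZ3.Theses.PercLowPointHalfSpace
open LowPoint (conn_symm conn_trans conn_refl conn_mono)

/-- The shift `ω ↦ ω + s` of bond configurations of `ℤ³` (local notation). -/
local notation3 (prettyPrint := false) "𝑻[" s "]" => BondConfig.relabel (sym2Equiv (Site.shift s))

/-- The half-space `ℍ = {0 ≤ x₀}` as written in the route file (local notation). -/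
local notation3 (prettyPrint := false) "𝐇" => ({x : Site 3 | 0 ≤ x 0} : Set (Site 3))

/-- The sup-norm cube `Q_s(x) = x + [-s, s]³` (local notation). -/
local notation3 (prettyPrint := false) "𝐐[" x ", " s "]" =>
  ({y : Site 3 | ∀ i : Fin 3, |y i - x i| ≤ ((s : ℕ) : ℤ)} : Set (Site 3))

/-- The localised point-to-wall event `W_r(x) = {x ↔ ∂ℍ inside Q_r(x)}` (local notation). -/
local notation3 (prettyPrint := false) "𝐖[" x ", " r "]" =>
  ({ω : BondConfig (Site 3) | ∃ f : Site 3, f 0 = 0 ∧ ω ∈ openConnIn 𝐐[x, r] x f} : Set (BondConfig (Site 3)))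

/-- The feet of `x`: floor points joined to `x` inside `Q_{2r}(x) ∩ ℍ` (local notation). -/
local notation3 (prettyPrint := false) "𝐅[" x ", " r ", " ω "]" =>
  ({f : Site 3 | f 0 = 0 ∧ ω ∈ openConnIn (𝐐[x, 2 * r] ∩ 𝐇) x f} : Set (Site 3))

/-- The local feet of a floor point `a`: floor points joined to `a` inside `Q_r(a) ∩ ℍ` (local notation). -/
local notation3 (prettyPrint := false) "𝐆[" a ", " r ", " ω "]" =>
  ({g : Site 3 | g 0 = 0 ∧ ω ∈ openConnIn (𝐐[a, r] ∩ 𝐇) a g} : Set (Site 3))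

/-- The transport weight `w_r(x) = 1/|F_r(x)|` (local notation). -/
local notation3 (prettyPrint := false) "𝐰[" x ", " r ", " ω "]" =>
  (((Set.encard 𝐅[x, r, ω] : ℕ∞) : ℝ≥0∞))⁻¹

/-- The vertical vector `r e₀` (local notation). -/
local notation3 (prettyPrint := false) "𝐞[" r "]" => (Pi.single 0 ((r : ℕ) : ℤ) : Site 3)

/-- The first transport function: mass `w_r(x)` from the apex `x = u + r e₀`, on `W_r(x)`, to the foot `v`
(local notation). -/
local notation3 (prettyPrint := false) "𝐟[" r ", " ω ", " u ", " v "]" =>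
  Set.indicator (𝐖[u + 𝐞[r], r] ∩ {ω' : BondConfig (Site 3) | v ∈ 𝐅[u + 𝐞[r], r, ω']})
    (fun ω' => 𝐰[u + 𝐞[r], r, ω']) ω

/-- The mass arriving at the origin from the apex above `u` (local notation). -/
local notation3 (prettyPrint := false) "𝚽[" r ", " u ", " ω "]" =>
  Set.indicator ({ω' : BondConfig (Site 3) | u 0 = 0} ∩ (𝐖[u + 𝐞[r], r] ∩
    {ω' : BondConfig (Site 3) | (0 : Site 3) ∈ 𝐅[u + 𝐞[r], r, ω']}))
    (fun ω' => 𝐰[u + 𝐞[r], r, ω']) ω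

/-- The fat indicator `𝟙{u ∈ ∂ℍ, 0 ∈ F_r(u + r e₀)}` (local notation). -/
local notation3 (prettyPrint := false) "𝚩[" r ", " u ", " ω "]" =>
  Set.indicator ({ω' : BondConfig (Site 3) | u 0 = 0} ∩
    {ω' : BondConfig (Site 3) | (0 : Site 3) ∈ 𝐅[u + 𝐞[r], r, ω']}) (1 : BondConfig (Site 3) → ℝ≥0∞) ω

/-- The thin transport summand: mass `w_r(x)` of the apex `x = u + r e₀`, routed through the thin foot `a`
(`x ↔ a` inside `Q_r(x)`, `|G_r(a)| < t`) to the receiver `b ∈ F_r(x)` (local notation). -/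
local notation3 (prettyPrint := false) "𝚿[" r ", " t ", " u ", " a ", " b ", " ω "]" =>
  Set.indicator ({ω' : BondConfig (Site 3) | u 0 = 0 ∧ a 0 = 0} ∩
    (openConnIn 𝐐[u + 𝐞[r], r] (u + 𝐞[r]) a ∩
      ({ω' : BondConfig (Site 3) | ((𝐆[a, r, ω']).ncard : ℝ) < t} ∩
        {ω' : BondConfig (Site 3) | b ∈ 𝐅[u + 𝐞[r], r, ω']})))
    (fun ω' => 𝐰[u + 𝐞[r], r, ω']) ω

namespace Stem

/-! ## Small tools -/

/-- The apex above a floor point lies at level `r`. [folklore] -/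
theorem apex_level {u : Site 3} (hu : u 0 = 0) (r : ℕ) : (u + 𝐞[r]) 0 = r := by
  simp [hu]

/-- Apexes commute with horizontal shifts: `(u + s) + r e₀ = (u + r e₀) + s`. [folklore] -/
theorem apex_shift (u s : Site 3) (r : ℕ) : u + s + 𝐞[r] = u + 𝐞[r] + s := add_right_comm u s _

/-- A sum over the floor supported above a finite set of level points is bounded by the corresponding
finite sum (`tsum_eq_sum` + reindexing by the apex map `u ↦ u + r e₀`). [folklore] -/
theorem tsum_le_sum_of_apex {h : Site 3 → ℝ≥0∞} {S : Finset (Site 3)} {c : Site 3 → ℝ≥0∞} (e : Site 3)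
    (hsupp : ∀ u, h u ≠ 0 → u + e ∈ S) (hle : ∀ x ∈ S, h (x - e) ≤ c x) :
    ∑' u, h u ≤ ∑ x ∈ S, c x := by
  have hs : ∀ u ∉ S.image (fun x => x - e), h u = 0 := by
    intro u hu
    by_contra hne
    exact hu (Finset.mem_image.2 ⟨u + e, hsupp u hne, add_sub_cancel_right u e⟩)
  rw [tsum_eq_sum hs, Finset.sum_image fun x _ y _ hxy => sub_left_injective hxy]
  exact Finset.sum_le_sum hle

/-- Summing the weight over the feet gives `1` (when there is a foot). [folklore] -/
theorem tsum_indicator_F_weight {x : Site 3} {r : ℕ} {ω : BondConfig (Site 3)} (hne : (𝐅[x, r, ω]).Nonempty) :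
    ∑' b : Site 3, (𝐅[x, r, ω]).indicator (fun _ => 𝐰[x, r, ω]) b = 1 := by
  rw [← tsum_subtype, ENNReal.tsum_set_const]
  exact encard_mul_weight hne

/-! ## Transport 1: `P(W_r) = E Σ_u 𝚽(u)` -/

/-- Measurability of the first transport function. [folklore] -/
theorem measurable_f (r : ℕ) (u v : Site 3) : Measurable fun ω : BondConfig (Site 3) => 𝐟[r, ω, u, v] :=
  (measurable_weight _ r).indicator ((measurableSet_W _ r).inter (measurableSet_mem_F _ v r))

/-- Diagonal invariance of the first transport function under horizontal shifts. [folklore] -/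
theorem f_shift (r : ℕ) (ω : BondConfig (Site 3)) (u v s : Site 3) (hs : s 0 = 0) :
    𝐟[r, 𝑻[s] ω, u + s, v + s] = 𝐟[r, ω, u, v] := by
  have hmem : 𝑻[s] ω ∈ 𝐖[u + s + 𝐞[r], r] ∩ {ω' : BondConfig (Site 3) | v + s ∈ 𝐅[u + s + 𝐞[r], r, ω']} ↔
      ω ∈ 𝐖[u + 𝐞[r], r] ∩ {ω' : BondConfig (Site 3) | v ∈ 𝐅[u + 𝐞[r], r, ω']} := by
    rw [apex_shift]
    exact and_congr (shift_mem_W_iff _ hs r ω) (add_mem_F_shift_iff _ v hs r ω)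
  by_cases h : ω ∈ 𝐖[u + 𝐞[r], r] ∩ {ω' : BondConfig (Site 3) | v ∈ 𝐅[u + 𝐞[r], r, ω']}
  · rw [Set.indicator_of_mem (hmem.2 h), Set.indicator_of_mem h, apex_shift, weight_shift _ hs]
  · rw [Set.indicator_of_notMem (fun h' => h (hmem.1 h')), Set.indicator_of_notMem h]

/-- Mass received at the origin's apex side: `Σ_v 𝟙{v ∈ ∂ℍ} f(ω, 0, v) = 𝟙_{W_r(0 + r e₀)}`. [folklore] -/
theorem tsum_f_zero (r : ℕ) (ω : BondConfig (Site 3)) :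
    ∑' v : Site 3, {v : Site 3 | v 0 = 0}.indicator (fun v => 𝐟[r, ω, 0, v]) v =
      (𝐖[(0 : Site 3) + 𝐞[r], r]).indicator 1 ω := by
  by_cases hW : ω ∈ 𝐖[(0 : Site 3) + 𝐞[r], r]
  · rw [Set.indicator_of_mem hW, Pi.one_apply]
    have hne : (𝐅[(0 : Site 3) + 𝐞[r], r, ω]).Nonempty := by
      obtain ⟨f, hf0, hf⟩ := hW
      exact ⟨f, mem_F_of_exit (apex_level rfl r) hf0 hf⟩
    rw [← tsum_indicator_F_weight hne]
    refine tsum_congr fun v => ?_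
    by_cases hv : v ∈ 𝐅[(0 : Site 3) + 𝐞[r], r, ω]
    · rw [Set.indicator_of_mem (show v ∈ {v : Site 3 | v 0 = 0} from hv.1), Set.indicator_of_mem hv,
        Set.indicator_of_mem (Set.mem_inter hW hv)]
    · rw [Set.indicator_of_notMem hv]
      by_cases hv0 : v 0 = 0
      · rw [Set.indicator_of_mem (show v ∈ {v : Site 3 | v 0 = 0} from hv0)]
        exact Set.indicator_of_notMem (fun h => hv h.2) _
      · exact Set.indicator_of_notMem (show v ∉ {v : Site 3 | v 0 = 0} from hv0) _
  · rw [Set.indicator_of_notMem hW]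
    refine ENNReal.tsum_eq_zero.2 fun v => ?_
    by_cases hv0 : v 0 = 0
    · rw [Set.indicator_of_mem (show v ∈ {v : Site 3 | v 0 = 0} from hv0)]
      exact Set.indicator_of_notMem (fun h => hW h.1) _
    · exact Set.indicator_of_notMem (show v ∉ {v : Site 3 | v 0 = 0} from hv0) _

/-- Mass sent towards the origin: `𝟙{u ∈ ∂ℍ} f(ω, u, 0) = 𝚽(u)`. [folklore] -/
theorem indicator_f_zero (r : ℕ) (ω : BondConfig (Site 3)) (u : Site 3) :
    {u : Site 3 | u 0 = 0}.indicator (fun u => 𝐟[r, ω, u, 0]) u = 𝚽[r, u, ω] := by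
  by_cases hu : u 0 = 0
  · rw [Set.indicator_of_mem (show u ∈ {u : Site 3 | u 0 = 0} from hu)]
    by_cases h : ω ∈ 𝐖[u + 𝐞[r], r] ∩ {ω' : BondConfig (Site 3) | (0 : Site 3) ∈ 𝐅[u + 𝐞[r], r, ω']}
    · rw [Set.indicator_of_mem h, Set.indicator_of_mem (show ω ∈ {ω' : BondConfig (Site 3) | u 0 = 0} ∩
        (𝐖[u + 𝐞[r], r] ∩ {ω' : BondConfig (Site 3) | (0 : Site 3) ∈ 𝐅[u + 𝐞[r], r, ω']}) from ⟨hu, h⟩)]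
    · rw [Set.indicator_of_notMem h, Set.indicator_of_notMem (fun h' => h h'.2)]
  · rw [Set.indicator_of_notMem (show u ∉ {u : Site 3 | u 0 = 0} from hu),
      Set.indicator_of_notMem (fun h' => hu h'.1)]

/-- **Transport 1.**  `P_p(W_r(0 + r e₀)) = ∫ Σ_u 𝚽(u) dP_p`. [folklore] -/
theorem lintegral_W_eq (p : unitInterval) (r : ℕ) :
    bondPercolation (zdGraph 3) p 𝐖[(0 : Site 3) + 𝐞[r], r] =
      ∫⁻ ω, ∑' u : Site 3, 𝚽[r, u, ω] ∂(bondPercolation (zdGraph 3) p) := by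
  rw [← lintegral_indicator_one (measurableSet_W _ r)]
  have h := _root_.Summit.CriticalPhenomena.PercolationContinuityZ3.Theorems.BoundaryTwoArmDecay.stub_census_floorMTP p (fun ω u v => 𝐟[r, ω, u, v])
    (fun u v => measurable_f r u v) (fun ω u v s hs => f_shift r ω u v s hs)
  simp only [tsum_f_zero, indicator_f_zero] at h
  exact h

/-! ## Transport 2: re-rooting the thin part at the thin foot -/

/-- Measurability of the thin summand. [folklore] -/
theorem measurable_Psi (r : ℕ) (t : ℝ) (u a b : Site 3) :
    Measurable fun ω : BondConfig (Site 3) => 𝚿[r, t, u, a, b, ω] :=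
  (measurable_weight _ r).indicator ((MeasurableSet.const _).inter
    ((measurableSet_openConnIn_of_countable _ _ _).inter
      ((measurableSet_thin a r t).inter (measurableSet_mem_F _ b r))))

/-- Diagonal invariance of the thin summand under horizontal shifts. [folklore] -/
theorem Psi_shift (r : ℕ) (t : ℝ) (ω : BondConfig (Site 3)) (u a b s : Site 3) (hs : s 0 = 0) :
    𝚿[r, t, u + s, a + s, b + s, 𝑻[s] ω] = 𝚿[r, t, u, a, b, ω] := by
  have hmem : 𝑻[s] ω ∈ {ω' : BondConfig (Site 3) | (u + s) 0 = 0 ∧ (a + s) 0 = 0} ∩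
      (openConnIn 𝐐[u + s + 𝐞[r], r] (u + s + 𝐞[r]) (a + s) ∩
        ({ω' : BondConfig (Site 3) | ((𝐆[a + s, r, ω']).ncard : ℝ) < t} ∩
          {ω' : BondConfig (Site 3) | b + s ∈ 𝐅[u + s + 𝐞[r], r, ω']})) ↔
      ω ∈ {ω' : BondConfig (Site 3) | u 0 = 0 ∧ a 0 = 0} ∩
        (openConnIn 𝐐[u + 𝐞[r], r] (u + 𝐞[r]) a ∩
          ({ω' : BondConfig (Site 3) | ((𝐆[a, r, ω']).ncard : ℝ) < t} ∩
            {ω' : BondConfig (Site 3) | b ∈ 𝐅[u + 𝐞[r], r, ω']})) := by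
    have hu0 : (u + s) 0 = 0 ↔ u 0 = 0 := by rw [Pi.add_apply, hs, add_zero]
    have ha0 : (a + s) 0 = 0 ↔ a 0 = 0 := by rw [Pi.add_apply, hs, add_zero]
    have hb0 : (b + s) 0 = 0 ↔ b 0 = 0 := by rw [Pi.add_apply, hs, add_zero]
    simp only [Set.mem_inter_iff, Set.mem_setOf_eq]
    rw [hu0, ha0, hb0, apex_shift, shift_mem_connCube_iff, ncard_G_shift a hs, shift_mem_connCubeH_iff _ _ _ hs]
  by_cases h : ω ∈ {ω' : BondConfig (Site 3) | u 0 = 0 ∧ a 0 = 0} ∩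
      (openConnIn 𝐐[u + 𝐞[r], r] (u + 𝐞[r]) a ∩
        ({ω' : BondConfig (Site 3) | ((𝐆[a, r, ω']).ncard : ℝ) < t} ∩
          {ω' : BondConfig (Site 3) | b ∈ 𝐅[u + 𝐞[r], r, ω']}))
  · rw [Set.indicator_of_mem (hmem.2 h), Set.indicator_of_mem h, apex_shift, weight_shift _ hs]
  · rw [Set.indicator_of_notMem (fun h' => h (hmem.1 h')), Set.indicator_of_notMem h]

/-- The floor indicators of the second transport are redundant (they are built into `𝚿`). [folklore] -/
theorem indicator_tsum_Psi (r : ℕ) (t : ℝ) (ω : BondConfig (Site 3)) (a b : Site 3)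
    (hab : a 0 ≠ 0 ∨ b 0 ≠ 0) : ∑' u : Site 3, 𝚿[r, t, u, a, b, ω] = 0 := by
  refine ENNReal.tsum_eq_zero.2 fun u => Set.indicator_of_notMem (fun h => ?_) _
  rcases hab with ha | hb
  · exact ha h.1.2
  · exact hb h.2.2.2.1

/-- **Transport 2** (floor MTP applied to `g(ω, a, b) = Σ_u 𝚿(u, a, b)`):
`∫ Σ_a Σ_u 𝚿(u, a, 0) = ∫ Σ_b Σ_u 𝚿(u, 0, b)`. [folklore] -/
theorem lintegral_Psi_swap (p : unitInterval) (r : ℕ) (t : ℝ) :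
    ∫⁻ ω, ∑' a : Site 3, ∑' u : Site 3, 𝚿[r, t, u, a, 0, ω] ∂(bondPercolation (zdGraph 3) p) =
      ∫⁻ ω, ∑' b : Site 3, ∑' u : Site 3, 𝚿[r, t, u, (0 : Site 3), b, ω] ∂(bondPercolation (zdGraph 3) p) := by
  have h := _root_.Summit.CriticalPhenomena.PercolationContinuityZ3.Theorems.BoundaryTwoArmDecay.stub_census_floorMTP p (fun ω a b => ∑' u : Site 3, 𝚿[r, t, u, a, b, ω])
    (fun a b => Measurable.tsum fun u => measurable_Psi r t u a b) (fun ω a b s hs => by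
      show ∑' u : Site 3, 𝚿[r, t, u, a + s, b + s, 𝑻[s] ω] = ∑' u : Site 3, 𝚿[r, t, u, a, b, ω]
      rw [← (Equiv.addRight s).tsum_eq]
      exact tsum_congr fun u => Psi_shift r t ω u a b s hs)
  have hL : ∀ ω : BondConfig (Site 3), ∀ b : Site 3, {b : Site 3 | b 0 = 0}.indicator
      (fun b => ∑' u : Site 3, 𝚿[r, t, u, (0 : Site 3), b, ω]) b = ∑' u : Site 3, 𝚿[r, t, u, (0 : Site 3), b, ω] := by
    intro ω b
    by_cases hb : b 0 = 0
    · exact Set.indicator_of_mem (show b ∈ {b : Site 3 | b 0 = 0} from hb) _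
    · rw [Set.indicator_of_notMem (show b ∉ {b : Site 3 | b 0 = 0} from hb),
        indicator_tsum_Psi r t ω 0 b (Or.inr hb)]
  have hR : ∀ ω : BondConfig (Site 3), ∀ a : Site 3, {a : Site 3 | a 0 = 0}.indicator
      (fun a => ∑' u : Site 3, 𝚿[r, t, u, a, 0, ω]) a = ∑' u : Site 3, 𝚿[r, t, u, a, 0, ω] := by
    intro ω a
    by_cases ha : a 0 = 0
    · exact Set.indicator_of_mem (show a ∈ {a : Site 3 | a 0 = 0} from ha) _
    · rw [Set.indicator_of_notMem (show a ∉ {a : Site 3 | a 0 = 0} from ha),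
        indicator_tsum_Psi r t ω a 0 (Or.inl ha)]
  simp only [hL, hR] at h
  exact h.symm

/-- **Received thin mass**: for each apex `x = u + r e₀`, `Σ_b 𝚿(u, 0, b) ≤ 𝟙{|G_r(0)| < t} 𝟙{x ↔ 0 in Q_r(x)}`
(the receiver sum of `𝟙{b ∈ F_r(x)} w_r(x)` is exactly `1`), and these apexes are points of `U ∩ L_r ∩ B_r`.
[folklore] -/
theorem tsum_tsum_Psi_le (r : ℕ) (t : ℝ) (ω : BondConfig (Site 3)) :
    ∑' b : Site 3, ∑' u : Site 3, 𝚿[r, t, u, (0 : Site 3), b, ω] ≤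
      ∑ x ∈ (box 3 r).filter (fun x : Site 3 => x 0 = (r : ℤ)),
        ({ω' : BondConfig (Site 3) | ((𝐆[(0 : Site 3), r, ω']).ncard : ℝ) < t} ∩ openConnIn 𝐇 0 x).indicator 1 ω := by
  rw [ENNReal.tsum_comm]
  -- evaluate the receiver sum for each apex
  have heval : ∀ u : Site 3, ∑' b : Site 3, 𝚿[r, t, u, (0 : Site 3), b, ω] =
      ({ω' : BondConfig (Site 3) | u 0 = 0} ∩ (openConnIn 𝐐[u + 𝐞[r], r] (u + 𝐞[r]) 0 ∩
        {ω' : BondConfig (Site 3) | ((𝐆[(0 : Site 3), r, ω']).ncard : ℝ) < t})).indicator 1 ω := by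
    intro u
    by_cases h : ω ∈ {ω' : BondConfig (Site 3) | u 0 = 0} ∩ (openConnIn 𝐐[u + 𝐞[r], r] (u + 𝐞[r]) 0 ∩
        {ω' : BondConfig (Site 3) | ((𝐆[(0 : Site 3), r, ω']).ncard : ℝ) < t})
    · obtain ⟨hu, hc, hthin⟩ := h
      have hu' : u 0 = 0 := hu
      rw [Set.indicator_of_mem (show ω ∈ {ω' : BondConfig (Site 3) | u 0 = 0} ∩
        (openConnIn 𝐐[u + 𝐞[r], r] (u + 𝐞[r]) 0 ∩
          {ω' : BondConfig (Site 3) | ((𝐆[(0 : Site 3), r, ω']).ncard : ℝ) < t}) from ⟨hu, hc, hthin⟩),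
        Pi.one_apply]
      have hne : (𝐅[u + 𝐞[r], r, ω]).Nonempty := ⟨0, mem_F_of_exit (apex_level hu' r) rfl hc⟩
      rw [← tsum_indicator_F_weight hne]
      refine tsum_congr fun b => ?_
      by_cases hb : b ∈ 𝐅[u + 𝐞[r], r, ω]
      · rw [Set.indicator_of_mem hb, Set.indicator_of_mem]
        exact ⟨⟨hu', rfl⟩, hc, hthin, hb⟩
      · rw [Set.indicator_of_notMem hb, Set.indicator_of_notMem (fun h' => hb h'.2.2.2)]
    · rw [Set.indicator_of_notMem h]
      refine ENNReal.tsum_eq_zero.2 fun b => Set.indicator_of_notMem (fun h' => h ?_) _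
      exact ⟨h'.1.1, h'.2.1, h'.2.2.1⟩
  simp only [heval]
  refine tsum_le_sum_of_apex (h := fun u : Site 3 => ({ω' : BondConfig (Site 3) | u 0 = 0} ∩
      (openConnIn 𝐐[u + 𝐞[r], r] (u + 𝐞[r]) 0 ∩
        {ω' : BondConfig (Site 3) | ((𝐆[(0 : Site 3), r, ω']).ncard : ℝ) < t})).indicator 1 ω)
    (c := fun x : Site 3 => ({ω' : BondConfig (Site 3) | ((𝐆[(0 : Site 3), r, ω']).ncard : ℝ) < t} ∩
      openConnIn 𝐇 0 x).indicator 1 ω) 𝐞[r] (fun u hu => ?_) (fun x _ => ?_)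
  · obtain ⟨hu0, hc, -⟩ : ω ∈ {ω' : BondConfig (Site 3) | u 0 = 0} ∩
        (openConnIn 𝐐[u + 𝐞[r], r] (u + 𝐞[r]) 0 ∩
          {ω' : BondConfig (Site 3) | ((𝐆[(0 : Site 3), r, ω']).ncard : ℝ) < t}) := by
      by_contra hc
      exact hu (Set.indicator_of_notMem hc _)
    have hu0' : u 0 = 0 := hu0
    exact Finset.mem_filter.2 ⟨(conn_H_of_conn_cube_zero (apex_level hu0' r) hc).2, apex_level hu0' r⟩
  · rw [sub_add_cancel]
    by_cases h : ω ∈ {ω' : BondConfig (Site 3) | (x - 𝐞[r]) 0 = 0} ∩ (openConnIn 𝐐[x, r] x 0 ∩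
        {ω' : BondConfig (Site 3) | ((𝐆[(0 : Site 3), r, ω']).ncard : ℝ) < t})
    · obtain ⟨hx0, hc, hthin⟩ := h
      have hx : x 0 = r := by
        have h1 : (x - 𝐞[r]) 0 = 0 := hx0
        simpa [sub_eq_zero] using h1
      rw [Set.indicator_of_mem (show ω ∈ {ω' : BondConfig (Site 3) | (x - 𝐞[r]) 0 = 0} ∩ (openConnIn 𝐐[x, r] x 0 ∩
        {ω' : BondConfig (Site 3) | ((𝐆[(0 : Site 3), r, ω']).ncard : ℝ) < t}) from ⟨hx0, hc, hthin⟩),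
        Set.indicator_of_mem (show ω ∈ {ω' : BondConfig (Site 3) | ((𝐆[(0 : Site 3), r, ω']).ncard : ℝ) < t} ∩
          openConnIn 𝐇 0 x from ⟨hthin, (conn_H_of_conn_cube_zero hx hc).1⟩)]
    · rw [Set.indicator_of_notMem h]
      exact zero_le

/-- **Thin part, integrated**: `∫ Σ_u Σ_a 𝚿(u, a, 0) ≤ Σ_{x ∈ B_r, x₀ = r} P(locFoot_r < t, 0 ↔_ℍ x)`. [folklore] -/
theorem lintegral_thin_le (p : unitInterval) (r : ℕ) (t : ℝ) :
    ∫⁻ ω, ∑' u : Site 3, ∑' a : Site 3, 𝚿[r, t, u, a, 0, ω] ∂(bondPercolation (zdGraph 3) p) ≤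
      ∑ x ∈ (box 3 r).filter (fun x : Site 3 => x 0 = (r : ℤ)), bondPercolation (zdGraph 3) p
        ({ω' : BondConfig (Site 3) | ((𝐆[(0 : Site 3), r, ω']).ncard : ℝ) < t} ∩ openConnIn 𝐇 0 x) := by
  have hswap : ∀ ω : BondConfig (Site 3), ∑' u : Site 3, ∑' a : Site 3, 𝚿[r, t, u, a, 0, ω] =
      ∑' a : Site 3, ∑' u : Site 3, 𝚿[r, t, u, a, 0, ω] := fun ω => ENNReal.tsum_comm
  simp only [hswap]
  rw [lintegral_Psi_swap]
  calc ∫⁻ ω, ∑' b : Site 3, ∑' u : Site 3, 𝚿[r, t, u, (0 : Site 3), b, ω] ∂(bondPercolation (zdGraph 3) p)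
      ≤ ∫⁻ ω, ∑ x ∈ (box 3 r).filter (fun x : Site 3 => x 0 = (r : ℤ)),
          ({ω' : BondConfig (Site 3) | ((𝐆[(0 : Site 3), r, ω']).ncard : ℝ) < t} ∩ openConnIn 𝐇 0 x).indicator 1 ω
            ∂(bondPercolation (zdGraph 3) p) := lintegral_mono fun ω => tsum_tsum_Psi_le r t ω
    _ = _ := by
      rw [lintegral_finsetSum _ fun x _ => measurable_one.indicator
        ((measurableSet_thin 0 r t).inter (measurableSet_openConnIn_of_countable _ _ _))]
      exact Finset.sum_congr rfl fun x _ => lintegral_indicator_one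
        ((measurableSet_thin 0 r t).inter (measurableSet_openConnIn_of_countable _ _ _))

end Stem

/-! ## Registered form -/

/-- **Registered sub-goal `stub_stemApexSum`** (crux stmt-CriticalPhenomena-14713, line SketchIdeator4, helper of
`stub_stemLevel`): a sum over the floor `ℤ²`-indexed apexes supported above a finite set of level points is bounded by
the corresponding finite sum (support + reindexing by `u ↦ u + r e₀`; the bookkeeping step shared by both transports).
[folklore] -/
theorem stub_stemApexSum : ∀ (h c : Site 3 → ℝ≥0∞) (S : Finset (Site 3)) (e : Site 3), (∀ u : Site 3, h u ≠ 0 → u + e ∈ S) → (∀ x ∈ S, h (x - e) ≤ c x) → ∑' u : Site 3, h u ≤ ∑ x ∈ S, c x :=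
  fun _ _ _ e hsupp hle => Stem.tsum_le_sum_of_apex e hsupp hle

end Summit.CriticalPhenomena.PercolationContinuityZ3.Theorems.StemCriterion

end
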